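import Summits.CriticalPhenomena.PercolationContinuityZ3.Theses.PercNonProliferation
import Summits.CriticalPhenomena.PercolationContinuityZ3.Theses.PercBudgetLadder
import Summits.CriticalPhenomena.PercolationContinuityZ3.Theorems.BudgetTightness.Negative.OffCritical
import Literature.Probability.Percolation.MinOpenCut

/-! Crux-triage r1-2 probe (refuter-cruxtri-stmt-CriticalPhenomena-4444-r1-2-0), crux `NonProliferation`.

1. the crux elaborates (`probe`);
2. card `supercritical-cut-descent`: its transfer C⁺ is, by its own descent + continuity, equivalent to
   critical min-cut tightness at aspect 2 (`CutTightnessAtPc` = the card's `∃ᶠ n, P_{p_c}(cutLE n M) ≥ c`).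
   Checked here, importing only LANDED files: `cutLE n M` is the budget event of the EXISTING crux
   `PercBudgetLadder.BudgetTightness` (stmt-CriticalPhenomena-5248) at `l = 2` (`cutLE_eq_budgetEvent`), so
   `CutTightnessAtPc → BudgetTightness` (`budgetTightness_of_cutTightnessAtPc`); the card's `firstLemma_descent`
   is the landed negative lemma `real_antitone_of_isLowerSet` (`descent`); and the supercritical analogue of the
   target is FALSE at every fixed `q > p_c` (`not_cutTightness_of_criticalProb_lt`, from the landed
   `budgetTightness_param_false_of_criticalProb_lt`, GKZ 1993 Lemma 5).
-/

open Literature.Probability.LatticeModels Literature.Probability.Percolation MeasureTheory Filter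
open Summit.CriticalPhenomena.PercolationContinuityZ3.Theorems.BudgetTightness.Negative
  (real_antitone_of_isLowerSet budgetEvent_eq_setOf_minCut isLowerSet_budgetEvent measurableSet_budgetEvent
   budgetTightness_param_false_of_criticalProb_lt)

noncomputable section

namespace TriageR12Probe

theorem probe :
    Summit.CriticalPhenomena.PercolationContinuityZ3.Theses.PercNonProliferation.NonProliferation := by
  sorry

/-- bond percolation on `ℤ³` at parameter `p`. -/
abbrev μ (p : unitInterval) : Measure (BondConfig (Site 3)) := bondPercolation (zdGraph 3) p

/-- card supercritical-cut-descent's `cutLE n M` = `{MinCut(B(2n); B(n), ∂⁻B(2n)) ≤ M}` (verbatim shape of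
`SketchIdeator2.cutLE`). -/
def cutLE (n M : ℕ) : Set (BondConfig (Site 3)) :=
  {ω | minOpenCutIn (↑(box 3 (2 * n)) : Set (Site 3)) ↑(box 3 n)
    ↑(innerBoundary (zdGraph 3) (box 3 (2 * n))) ω ≤ M}

/-- min-cut tightness at aspect 2 and parameter `p` (the card's target is `p = p_c`; its C⁺ quantifies over
`q > p_c` with `n` depending on `q`). -/
def CutTightnessAt (p : unitInterval) : Prop :=
  ∃ (M : ℕ) (c : ℝ), 0 < c ∧ ∃ᶠ n : ℕ in atTop, c ≤ (μ p).real (cutLE n M)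

/-- Critical min-cut tightness at aspect 2: what C⁺ of the card is equivalent to. -/
def CutTightnessAtPc : Prop := CutTightnessAt (criticalProbI 3)

/-- `cutLE n M` is literally the budget-`M` blocking event of crux 5248 at aspect `l = 2`. -/
theorem cutLE_eq_budgetEvent (n M : ℕ) :
    cutLE n M = {ω : BondConfig (Site 3) | ∃ S : Finset (Sym2 (Site 3)), S.card ≤ M ∧
      ¬ ∃ x ∈ box 3 n, ∃ y ∈ innerBoundary (zdGraph 3) (box 3 (2 * n)),
        (ω \ ↑S) ∈ openConnIn (↑(box 3 (2 * n)) : Set (Site 3)) x y} := by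
  rw [budgetEvent_eq_setOf_minCut]; rfl

/-- `CutTightnessAt p` in the exact shape of `PercBudgetLadder.BudgetTightness` with the parameter freed
(`k = M`, `l = 2`). -/
theorem budgetShape_of_cutTightnessAt {p : unitInterval} (h : CutTightnessAt p) :
    ∃ (k l : ℕ) (c : ℝ), 2 ≤ l ∧ 0 < c ∧ ∀ N : ℕ, ∃ n : ℕ, N ≤ n ∧
      c ≤ (bondPercolation (zdGraph 3) p).real
        {ω : BondConfig (Site 3) | ∃ S : Finset (Sym2 (Site 3)), S.card ≤ k ∧
          ¬ ∃ x ∈ box 3 n, ∃ y ∈ innerBoundary (zdGraph 3) (box 3 (l * n)),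
            (ω \ ↑S) ∈ openConnIn (↑(box 3 (l * n)) : Set (Site 3)) x y} := by
  obtain ⟨M, c, hc, hf⟩ := h
  refine ⟨M, 2, c, le_rfl, hc, fun N => ?_⟩
  obtain ⟨n, hn, hcn⟩ := Filter.frequently_atTop.1 hf N
  exact ⟨n, hn, by rwa [← cutLE_eq_budgetEvent]⟩

/-- **The card's transfer target implies the EXISTING crux `BudgetTightness` (stmt-CriticalPhenomena-5248,
route PercBudgetLadder) with `l = 2`.** -/
theorem budgetTightness_of_cutTightnessAtPc (h : CutTightnessAtPc) :
    Summit.CriticalPhenomena.PercolationContinuityZ3.Theses.PercBudgetLadder.BudgetTightness :=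
  budgetShape_of_cutTightnessAt h

/-- The card's `firstLemma_descent` is a one-line instance of the LANDED negative lemma
`real_antitone_of_isLowerSet` (decreasing event + monotone coupling): the supercritical probability is
pointwise (in `n`) SMALLER, so a supercritical witness is a critical witness obtained under worse odds. -/
theorem descent (n M : ℕ) (q : unitInterval) (hq : criticalProbI 3 ≤ q) :
    (μ q).real (cutLE n M) ≤ (μ (criticalProbI 3)).real (cutLE n M) := by
  rw [cutLE_eq_budgetEvent]
  exact real_antitone_of_isLowerSet _ (isLowerSet_budgetEvent M n (2 * n))
    (measurableSet_budgetEvent M n (2 * n)) hq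

/-- Hence `CutTightnessAt` is antitone in the parameter … -/
theorem cutTightnessAt_antitone {p q : unitInterval} (hpq : p ≤ q) (h : CutTightnessAt q) :
    CutTightnessAt p := by
  obtain ⟨M, c, hc, hf⟩ := h
  refine ⟨M, c, hc, hf.mono fun n hn => hn.trans ?_⟩
  rw [cutLE_eq_budgetEvent]
  exact real_antitone_of_isLowerSet _ (isLowerSet_budgetEvent M n (2 * n))
    (measurableSet_budgetEvent M n (2 * n)) hpq

/-- … and **FALSE at every fixed supercritical parameter** (landed GKZ-type negative lemma of crux 5248):
the supercritical phase has cheap cuts only at bounded scales, i.e. only where it is indistinguishable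
from `p_c` — the "descent" cannot import anything from `q > p_c`. -/
theorem not_cutTightnessAt_of_criticalProb_lt (q : unitInterval)
    (hq : criticalProb (zdGraph 3) (0 : Site 3) < q) : ¬ CutTightnessAt q :=
  fun h => budgetTightness_param_false_of_criticalProb_lt q hq (budgetShape_of_cutTightnessAt h)

end TriageR12Probe

end
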